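/-
Copyright: lit-balaban Phase-2 proof seat p08 (gen 8).  Statement-level skeleton of a published paper; no proof claims beyond what
the kernel checks below.
-/
import Literature.MathematicalPhysics.QuantumFieldTheory.BalabanImbrieJaffe1984to88.BIJ88Decay223CkTerm
import Literature.MathematicalPhysics.QuantumFieldTheory.BalabanImbrieJaffe1984to88.BIJ88Decay216Prop12

/-!
# `BalabanImbrieJaffe1984to88.BIJ88Decay223CkTorus` — T. Bałaban, J. Imbrie, A. Jaffe, *Effective action and cluster properties of the
abelian Higgs model*, Commun. Math. Phys. **114** (1988) 257–315 [BalabanImbrieJaffe1988]: **(2.23)** p. 262 — *"|C_k(x,b′)| ≦ ce^{−c dist(x,b′)},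
dist(x,b′) > c"* — PROVED ON THE TORI OF THE SERIES FOR THE `C_k` OF RECORD, seat p08 g7's `BIJ88Eq220Torus.CkE P hd η_k^d L^k k` ((2.22)
verbatim, the kernel generating the gauge transformation in (2.20)), GIVEN ONLY [6I] PROPOSITION 1.2 BY ITS TREE NAME (file 3 of 3; file 1 =
`BIJ88Decay223CkKernel`, the entries; file 2 = `BIJ88Decay223CkTerm`, the scale-`j` term): the p. 262 argument *"The kernels of all these operators have an exponential decay on their respective
length scales; for D_k the required estimate is (I.7.2.4). … For more distant points, however, the rapid decay of terms with small j controls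
the scalings and the sum over j to yield a uniform bound"* carried out — the `D_k` term by [I] (7.2.4) for the `D_k` of record (file 1), the
scale-`j` term `D_jC^{(j)}H_j^*∂*Q^{e*}_k∂` by file 2's bound with the NATIVE (7.2.3) rescaled to the `L^jη` lattice (r18's
`abs_inner_cE_ambient_eq`, one scaling factor `(L^{k−j})^{d−2}`), and the sum over `j` by `(L^{k−j})^{d−2}e^{−a₀L^{k−j}} ≤ (d−1)!/(a₀^{d−1}L^{k−j})`,
`Σ_{j<k}L^{−(k−j)} ≤ 1`

statement-level skeleton of published theorems with citation tags; proofs where landed; nothing here is a claim about the Yang–Mills mass gap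

PDF held: `paper:balaban1988-cmp114-bij-abelian-higgs-effective-action` (journal page = PDF page + 256), p. 262 [PDF 6] (text layer
`~/.lit/texts/paper-balaban1988-cmp114-bij-abelian-higgs-effective-action/p0006.txt`, re-read this session); [I] = [BalabanImbrieJaffe1985]
(`paper:balaban1985-cmp97-bij-higgs-minimizers`) pp. 325–326 (7.2.2)–(7.2.4); [6I] = [Balaban1984PropagatorsI] Prop. 1.2 (tree name
`Balaban1983to89.B5.Prop12Printed`).

CITATION HEADER (lean-in-tree rule).  Part of the lit-balaban TYPED SKELETON (HOME `run/shared/lean/pub/lit-balaban/`), Phase-2 proof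
seat p08 (gen 8), unit `lit-balaban-p08`; WHAT IS REPRODUCED = SKELETON row **C2.Eq2.23** (reader file `HOME/lit-balaban-r18/ROWS-C2.md`,
owner r18, referee ref-5; head *"proved p249538 (p08 g4; hence-step from per-scale kernel bounds, D_k slot = (I.7.2.4) hypothesis edge)"*),
kind «model instance for the operator of record»: the hence-step is carried out for the CONCRETE `C_k` of row **C2.Eq2.22** on the tori
(p08 g7 p255966 `BIJ88Eq220Torus`), the per-scale inputs DISCHARGED down to [6I] Prop. 1.2 — rows **C1.Eq7.2.1-7.2.2** (r15's typed
`KernelData.Ineq722`; on the tori from `B5.Prop12Printed`: p09 `ineq722_deltaA_of_prop12Printed`), **C1.Eq7.2.3** (hypothesis-free on the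
tori: p09 g6 p266116 `ineq723_CE_lt`), **C1.Eq7.2.4** (p08 g3 `abs_Dk_le`, read for the `D_j` of record in file 1); r18's typed one-letter
`BIJ88Sect2Statements.DecayFar` INHABITED for this kernel in a rescaled distance.  TAKING line HOME/STATUS.md 2026-08-21T18:13:52Z (B).
Decls used BY NAME (nothing restated): files 1–2; p08's `BIJ88Ineq217Ineq722Torus.exists_bound_of_ineq722`, `BIJ88Decay216Prop12.ineq723_CE_torus`; r18's `BIJ88Decay216Native.abs_inner_cE_ambient_le`;
p09's `torusKernelData`/`levStd`/`ineq722_deltaA_of_prop12Printed`; r18's typed `DecayFar`; r15's typed `KernelData.Ineq722`.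

THE PRINTED TEXT (p. 262 [PDF 6], verbatim): *"C_k = D_k + Σ_{j=0}^{k−1} D^{L^jη}_jC^{(j),L^jη}H^{*L^jη}_j∂*Q^{e*}_k∂. (2.22) The kernels of all
these operators have an exponential decay on their respective length scales; for D_k the required estimate is (I.7.2.4). The sum over j is not
well controlled for close points; this will not be important for us. For more distant points, however, the rapid decay of terms with small j
controls the scalings and the sum over j to yield a uniform bound |C_k(x,b′)| ≦ ce^{−c dist(x,b′)}, dist(x,b′) > c. (2.23) Here x ∈ T_η^{(k)},
b′ ∈ T₁^{(k)*}. Of course there is no uniform bound on ∂C_k."*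

THE TORUS DATA: as in file 1 — `C_k(x, b′) := (CkE P hd η_k^d L^k k e_{b′})(x)`, `x ∈ T_η = TSite P 0`, `b′ ∈ T₁^{(k)*} = PBond P k`,
`dist(x, b′) := distEU P k x b′₋ = |x − ctr_k(b′₋)|_∞/L^k` (the fine-site-to-block distance in the unit of `T₁^{(k)}`); `H_j` = the (7.2.1)
kernels of p09's torus carriers `torusRep P j (deltaAData …)` (scales `levStd`), `C^{(j)} = CE P η_j^d L^j j` (native, unit lattice).

WHAT IS PROVED (0 `sorry`, standard axioms; theorems only — proof lane; every `d ≥ 2`):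
* §1 **`abs_CkKernel_le`** — **(2.23) WITH EXPLICIT CONSTANTS**: given the `|H|`, `|∇H|` members of (7.2.2) for `H_j`, `j ≤ k` (constants
  `M, δ`) and the NATIVE (7.2.3) for `CE P η_j^d L^j j`, `j < k` (constants `M_C, δ_C`), for `dist(x,b′) ≥ 2δ/a₀ + 4`:
  `|C_k(x,b′)| ≤ (dMe^{δ} + N_∂·2d³M²e^{δ}M_CK₀·(d−1)!/a₀^{d−1})·e^{−(a₀/2)·dist(x,b′)}` — constants INDEPENDENT of `k` and of the volume.
* §2 **`decay223_Ck_torus_of_ineq722_lt`** (H-input from r15's typed `KernelData.Ineq722` for p09's torus kernel family, C-input = the native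
  (7.2.3) in the binder shape `∀ k ≤ m + K, ∀ j < k`: ONE triple `(R₀, c₀, δ′)` for all `k ≤ m + K`), **`decay223_Ck_torus_prop12`**
  (**GIVEN ONLY `B5.Prop12Printed`** for the `levStd` torus family: `∃ R₀ c₀ δ′, 0 < δ′ ∧ 0 ≤ c₀ ∧ ∀ k ≤ m + K, ∀ x b′, R₀ ≤ dist(x,b′) →
  |C_k(x,b′)| ≤ c₀e^{−δ′dist(x,b′)}`).
* §3 `decayFar_of_decay3` (a three-constant decay beyond a threshold inhabits r18's one-letter `DecayFar` in the rescaled distance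
  `κ·dist`, `κ = min(δ′/c, c/max(R₀,1))`, `c = max(c₀,1)`), **`decayFar223_Ck_torus_prop12`** (`∃ κ > 0, c > 0, ∀ k ≤ m + K,
  DecayFar (κ·dist) C_k c` — row C2.Eq2.23's typed shape for the kernel of record, from `B5.Prop12Printed` alone).
HONEST SCOPE.  (i) The one remaining hypothesis is [6I] Proposition 1.2 BY NAME (the `h12` of rows C1.Eq7.2.1-7.2.2 / C2.Eq2.16's files);
constants existential PER TORUS `P` as in every file of the lane (uniform in `k ≤ m + K`).  (ii) `dist(x, b′)` read as the `ℓ^∞` distance from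
the fine site `x` to the centre of the block of `b′₋`, in the unit of `T₁^{(k)}` (r15's `KernelData.distEB` slot is a free parameter of p09's
carrier; the (7.2.4) files use the same reading up to the documented half-block slack); r18's one-letter `DecayFar dist K c` (threshold =
prefactor = rate) is inhabited only after the rescaling `κ·dist` (as for `Decay` in `BIJ88HkLocTorus`), the three-constant form being the
faithful one.  (iii) `U = 1`, real abelian fields, torus, standing range; nothing on `∂C_k` (*"no uniform bound"*) nor on (2.24)–(2.26).
(iv) No `def`, no new named fact, nothing restated; NOT summit progress.  Unit `lit-balaban-p08` (literature-prover-lit-balaban-p08-g8-0),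
2026-08-21.
-/

open scoped BigOperators RealInnerProductSpace

namespace Literature.MathematicalPhysics.QuantumFieldTheory.BalabanImbrieJaffe1984to88.BIJ88Decay223CkTorus

open Balaban1983to89 hiding Site Plaq
open Balaban1983to89.LatticeFieldCalculus
open Balaban1983to89.B3TorusRadialSums (supDist_comm supDist_eq_zero_iff)
open BIJ88SigmaKernelDkTorus BIJ88Ineq217Ineq722Torus BIJ88Ineq217NearPart BIJ88Decay216Torus
open BIJ85AxialPropagator411 BIJ85Prop521Torus BIJ85Sigma421Torus BIJ85Prop522Torus BIJ85Sigma422Eta BIJ85Prop511Torus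
open BIJ85Eq611Torus (dOne)
open BIJ85Sect7Statements BIJ85Ineq722Torus BIJ85Eq721MinimizerKernel
open BIJ85Ineq722DeltaA (deltaAData ineq722_deltaA_of_prop12Printed)
open BIJ85Ineq722ProofPart2 (settingOf)
open BIJ88Sect2Statements (DecayFar)
open BIJ88Eq220Torus (DjE CkE)
open BIJ88Decay216Native (abs_inner_cE_ambient_le)
open BIJ88Decay216Prop12 (ineq723_CE_torus)
open BIJ88Decay223CkKernel BIJ88Decay223CkTerm

open Balaban1983to89 renaming Site → TSite, Plaq → TPlaq

noncomputable section

variable {P : Params}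

/-- `0 < L^n` in `ℝ`. [folklore] -/
private theorem cast_pow_L_pos' (n : ℕ) : (0 : ℝ) < (P.L : ℝ) ^ n := pow_pos P.cast_L_pos n

/-! ## §1  (2.23): the multiscale sum — «the rapid decay of terms with small j controls the scalings and the sum over j» -/

/-- `x^q·e^{−ax} ≤ (q+1)!/(a^{q+1}x)` (r18 g8's private lemma, re-proved). [folklore] -/
private theorem pow_mul_exp_neg_le {a x : ℝ} (ha : 0 < a) (hx : 0 < x) (q : ℕ) :
    x ^ q * Real.exp (-(a * x)) ≤ ((q + 1).factorial : ℝ) / (a ^ (q + 1) * x) := by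
  have h := Real.pow_div_factorial_le_exp (a * x) (by positivity) (q + 1)
  rw [div_le_iff₀ (by positivity)] at h
  rw [le_div_iff₀ (by positivity)]
  calc x ^ q * Real.exp (-(a * x)) * (a ^ (q + 1) * x) = (a * x) ^ (q + 1) * Real.exp (-(a * x)) := by ring
    _ ≤ Real.exp (a * x) * ((q + 1).factorial : ℝ) * Real.exp (-(a * x)) := mul_le_mul_of_nonneg_right h (Real.exp_pos _).le
    _ = ((q + 1).factorial : ℝ) := by
        rw [mul_comm (Real.exp _), mul_assoc, ← Real.exp_add, add_neg_cancel, Real.exp_zero, mul_one]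

/-- `Σ_{j<k} L^{−(k−j)} ≤ 1` (`L ≥ 2`; p08 g7's private lemma, re-proved). [folklore] -/
private theorem sum_inv_pow_le_one (k : ℕ) : ∑ j ∈ Finset.range k, ((P.L : ℝ) ^ (k - j))⁻¹ ≤ 1 := by
  have hL1 : (1 : ℝ) < P.L := by exact_mod_cast P.hL.2
  have hL0 : (0 : ℝ) < P.L := by linarith
  set x : ℝ := (P.L : ℝ)⁻¹ with hx
  have hx0 : 0 ≤ x := by rw [hx]; positivity
  have hx1 : x < 1 := by rw [hx]; exact inv_lt_one_of_one_lt₀ hL1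
  have hx2 : x ≤ 1 / 2 := by
    rw [hx]
    have : (2 : ℝ) ≤ P.L := by exact_mod_cast P.hL.2
    exact (inv_le_inv₀ hL0 two_pos).2 this |>.trans (by norm_num)
  have hre : ∑ j ∈ Finset.range k, ((P.L : ℝ) ^ (k - j))⁻¹ = ∑ i ∈ Finset.range k, x ^ (i + 1) := by
    rw [← Finset.sum_range_reflect]
    refine Finset.sum_congr rfl fun i hi => ?_
    rw [Finset.mem_range] at hi
    rw [hx, inv_pow, show k - (k - 1 - i) = i + 1 by omega]
  rw [hre]
  have hgeom : ∑ i ∈ Finset.range k, x ^ (i + 1) = x * ((x ^ k - 1) / (x - 1)) := by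
    rw [← geom_sum_eq hx1.ne k, Finset.mul_sum]
    exact Finset.sum_congr rfl fun i _ => by ring
  rw [hgeom]
  have h1x : 0 < 1 - x := by linarith
  have hxk : 0 ≤ x ^ k := pow_nonneg hx0 k
  rw [show (x ^ k - 1) / (x - 1) = (1 - x ^ k) / (1 - x) by
    rw [← neg_sub 1 (x ^ k), ← neg_sub 1 x, neg_div_neg_eq]]
  rw [← mul_div_assoc, div_le_one h1x]
  nlinarith

/-- **(2.23) ON THE TORI FOR THE `C_k` OF RECORD, EXPLICIT CONSTANTS**: given the `|H|` member of (7.2.2) for every `H_j`, `j ≤ k`,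
its `|∇H|` member for `j < k` (constants `M, δ`, fine-site distance `distEU`) and the NATIVE (7.2.3) `|⟨e_b, C^{(j)}e_{b′}⟩| ≤ M_Ce^{−δ_C|b₋−b′₋|_∞}`
for the unit-lattice `CE P η_j^d L^j j`, `j < k`: for `dist(x,b′) ≥ 2δ/a₀ + 4` (`a₀ = min(δ,δ_C)/2`),
`|C_k(x, b′)| ≤ (dMe^{δ} + N_∂·2d³M²e^{δ}M_CK₀·(d−1)!/a₀^{d−1})·e^{−(a₀/2)dist(x,b′)}` — the `D_k` term by file 1's (7.2.4) bound at `j = k`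
(*"for D_k the required estimate is (I.7.2.4)"*), the scale-`j` term by §2 fed the rescaled constant `M_C(L^{k−j})^{d−2}`
(`abs_inner_cE_ambient_le`), then `e^{(δ+a₀)ℓ}e^{−a₀ℓD} ≤ e^{−a₀ℓ}e^{−(a₀/2)D}` for `D ≥ 2δ/a₀ + 4`, `ℓ^{d−2}e^{−a₀ℓ} ≤ (d−1)!/(a₀^{d−1}ℓ)` and
`Σ_{j<k}L^{−(k−j)} ≤ 1` (`ℓ = L^{k−j}`) — *"the rapid decay of terms with small j controls the scalings and the sum over j"*; constants
INDEPENDENT of `k` and of the volume. [cite: BalabanImbrieJaffe1988, (2.23) p.262] -/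
theorem abs_CkKernel_le (hd : 2 ≤ P.d) {k : ℕ} (hk : k ≤ P.m + P.K) {a : ℝ} (ha : 0 < a) {δ M δC MC : ℝ}
    (hδ : 0 < δ) (hδC : 0 < δC) (hM : 0 ≤ M) (hMC : 0 ≤ MC)
    (hH : ∀ (j : ℕ) (hj : j ≤ P.m + P.K), j ≤ k → ∀ (μ ν : Fin P.d) (x'' : TSite P 0) (y : TSite P j),
      |(torusRep P j (deltaAData hj a)).H (x'', μ) (y, ν)| ≤ M * Real.exp (-(δ * distEU P j x'' y)))
    (hB : ∀ (j : ℕ) (hj : j ≤ P.m + P.K), j < k → ∀ (μ ν : Fin P.d) (x : TSite P 0) (y : TSite P j),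
      ‖fun lam : Fin P.d => (P.L : ℝ) ^ j *
          ((torusRep P j (deltaAData hj a)).H (x.shift lam, μ) (y, ν) - (torusRep P j (deltaAData hj a)).H (x, μ) (y, ν))‖ ≤
        M * Real.exp (-(δ * distEU P j x y)))
    (hC : ∀ j < k, ∀ b b' : PBond P j, |⟪toEj P j (Pi.single b 1),
      CE P ((P.eta j) ^ P.d) ((P.L : ℝ) ^ j) j (toEj P j (Pi.single b' 1))⟫| ≤ MC * Real.exp (-(δC * (supDist b.src b'.src : ℝ))))
    {x : TSite P 0} {b' : PBond P k} (hD : 2 * δ / (min δ δC / 2) + 4 ≤ distEU P k x b'.src) :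
    |CkE P hd ((P.eta k) ^ P.d) ((P.L : ℝ) ^ k) k (toEj P k (Pi.single b' 1)) x| ≤
      ((P.d : ℝ) * M * Real.exp δ +
        4 * (Real.exp P.d * ((P.d : ℝ) ^ 2 * (2 * (1 + (1:ℝ)⁻¹)) ^ P.d)) *
          (2 * (P.d : ℝ) ^ 3 * M ^ 2 * Real.exp δ * MC *
            (Real.exp (min δ δC / 2 / 2) * ((2 * (1 + P.d / (min δ δC / 2))) ^ P.d) ^ 2)) *
          (((P.d - 2 + 1).factorial : ℝ) / (min δ δC / 2) ^ (P.d - 2 + 1))) *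
        Real.exp (-(min δ δC / 2 / 2 * distEU P k x b'.src)) := by
  set a₀ : ℝ := min δ δC / 2 with ha₀
  have ha₀p : 0 < a₀ := by rw [ha₀]; exact half_pos (lt_min hδ hδC)
  have ha₀δ : a₀ ≤ δ := by rw [ha₀]; linarith [min_le_left δ δC, (lt_min hδ hδC).le]
  set D : ℝ := distEU P k x b'.src with hDdef
  set N : ℝ := 4 * (Real.exp P.d * ((P.d : ℝ) ^ 2 * (2 * (1 + (1:ℝ)⁻¹)) ^ P.d)) with hN
  set K₀ : ℝ := Real.exp (a₀ / 2) * ((2 * (1 + P.d / a₀)) ^ P.d) ^ 2 with hK₀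
  set G : ℝ := 2 * (P.d : ℝ) ^ 3 * M ^ 2 * Real.exp δ * MC * K₀ with hG
  have hN0 : 0 ≤ N := by positivity
  have hG0 : 0 ≤ G := by positivity
  have hD0 : 0 ≤ D := div_nonneg (Nat.cast_nonneg _) (cast_pow_L_pos' k).le
  have hD' : 2 * δ + 4 * a₀ ≤ a₀ * D := by
    have h := mul_le_mul_of_nonneg_left hD ha₀p.le
    have e : a₀ * (2 * δ / a₀ + 4) = 2 * δ + 4 * a₀ := by field_simp
    linarith
  have hw : 0 < (P.eta k) ^ P.d := pow_pos (eta_pos P k) _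
  rw [CkE_single_apply]
  refine (abs_add_le _ _).trans ?_
  rw [add_mul]
  refine add_le_add ?_ ?_
  · -- the `D_k` term: (I.7.2.4)
    have h := abs_DjE_single_le (k := k) hk hw ha hδ.le hM (hH k hk le_rfl) x b'
    rw [div_self (cast_pow_L_pos' k).ne', mul_one] at h
    refine h.trans ?_
    rw [← hDdef]
    have e1 : (P.d : ℝ) * (M * Real.exp δ) * Real.exp (-(δ * D)) = (P.d : ℝ) * M * Real.exp δ * Real.exp (-(δ * D)) := by ring
    rw [e1]
    refine mul_le_mul_of_nonneg_left (Real.exp_le_exp.2 ?_) (by positivity)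
    nlinarith
  · -- the scale-`j` terms
    have hterm : ∀ j ∈ Finset.range k,
        |DjE P ((P.eta k) ^ P.d) ((P.L : ℝ) ^ k) j (CE P ((P.eta k) ^ P.d) ((P.L : ℝ) ^ k) j
          (LinearMap.adjoint (HkE P ((P.eta k) ^ P.d) ((P.L : ℝ) ^ k) j)
            (LinearMap.adjoint (curlOp (P := P) ((P.eta k) ^ P.d) ((P.L : ℝ) ^ k))
              (QesOp (P := P) hd ((P.eta k) ^ P.d) k (dOne P k ((P.L : ℝ) ^ k) (toEj P k (Pi.single b' 1))))))) x| ≤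
          N * G * (((P.d - 2 + 1).factorial : ℝ) / (a₀ ^ (P.d - 2 + 1) * (P.L : ℝ) ^ (k - j))) *
            Real.exp (-(a₀ / 2 * D)) := by
      intro j hjm
      have hjk : j < k := Finset.mem_range.1 hjm
      have hj : j ≤ P.m + P.K := by omega
      set ℓ : ℝ := (P.L : ℝ) ^ (k - j) with hℓ
      have hℓ1 : 1 ≤ ℓ := one_le_pow₀ (by exact_mod_cast P.L_pos)
      have hℓ0 : 0 < ℓ := by linarith
      have hMCj : 0 ≤ MC * ℓ ^ (P.d - 2) := by positivity
      have h := abs_termCk_le hd hk hj hjk.le ha hδ hδC hM hMCj (hH j hj hjk.le) (hB j hj hjk)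
        (abs_inner_cE_ambient_le hd hjk.le (hC j hjk)) x b'
      refine h.trans ?_
      rw [← ha₀, ← hK₀, ← hℓ, ← hDdef, ← hN]
      have e1 : N * (2 * (P.d : ℝ) ^ 3 * M ^ 2 * Real.exp δ * (MC * ℓ ^ (P.d - 2)) * K₀) * Real.exp ((δ + a₀) * ℓ) *
          Real.exp (-(a₀ * (ℓ * D))) = N * G * (ℓ ^ (P.d - 2) * (Real.exp ((δ + a₀) * ℓ) * Real.exp (-(a₀ * (ℓ * D))))) := by
        rw [hG]; ring
      rw [e1, mul_assoc (N * G)]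
      refine mul_le_mul_of_nonneg_left ?_ (mul_nonneg hN0 hG0)
      have h2 : Real.exp ((δ + a₀) * ℓ) * Real.exp (-(a₀ * (ℓ * D))) ≤ Real.exp (-(a₀ * ℓ)) * Real.exp (-(a₀ / 2 * D)) := by
        rw [← Real.exp_add, ← Real.exp_add]
        refine Real.exp_le_exp.2 ?_
        have h3 := mul_le_mul_of_nonneg_left hD' (show (0 : ℝ) ≤ ℓ - 1 / 2 by linarith)
        nlinarith [h3, hℓ1, hδ.le, ha₀p.le, hD0, mul_nonneg ha₀p.le hD0, mul_nonneg (add_nonneg hδ.le ha₀p.le) (sub_nonneg.2 hℓ1)]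
      have h4 : ℓ ^ (P.d - 2) * Real.exp (-(a₀ * ℓ)) ≤ ((P.d - 2 + 1).factorial : ℝ) / (a₀ ^ (P.d - 2 + 1) * ℓ) :=
        pow_mul_exp_neg_le ha₀p hℓ0 (P.d - 2)
      calc ℓ ^ (P.d - 2) * (Real.exp ((δ + a₀) * ℓ) * Real.exp (-(a₀ * (ℓ * D))))
          ≤ ℓ ^ (P.d - 2) * (Real.exp (-(a₀ * ℓ)) * Real.exp (-(a₀ / 2 * D))) := mul_le_mul_of_nonneg_left h2 (by positivity)
        _ = ℓ ^ (P.d - 2) * Real.exp (-(a₀ * ℓ)) * Real.exp (-(a₀ / 2 * D)) := by ring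
        _ ≤ ((P.d - 2 + 1).factorial : ℝ) / (a₀ ^ (P.d - 2 + 1) * ℓ) * Real.exp (-(a₀ / 2 * D)) :=
            mul_le_mul_of_nonneg_right h4 (Real.exp_pos _).le
    calc _ ≤ ∑ j ∈ Finset.range k, N * G * (((P.d - 2 + 1).factorial : ℝ) / (a₀ ^ (P.d - 2 + 1) * (P.L : ℝ) ^ (k - j))) *
            Real.exp (-(a₀ / 2 * D)) := (Finset.abs_sum_le_sum_abs _ _).trans (Finset.sum_le_sum hterm)
      _ = N * G * (((P.d - 2 + 1).factorial : ℝ) / a₀ ^ (P.d - 2 + 1)) * Real.exp (-(a₀ / 2 * D)) *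
            ∑ j ∈ Finset.range k, ((P.L : ℝ) ^ (k - j))⁻¹ := by
          rw [Finset.mul_sum]
          refine Finset.sum_congr rfl fun j _ => ?_
          field_simp
      _ ≤ N * G * (((P.d - 2 + 1).factorial : ℝ) / a₀ ^ (P.d - 2 + 1)) * Real.exp (-(a₀ / 2 * D)) * 1 :=
          mul_le_mul_of_nonneg_left (sum_inv_pow_le_one k) (by positivity)
      _ = _ := by rw [mul_one, hG]

/-! ## §2  (2.23) from the typed (7.2.2) and the native (7.2.3); from [6I] Proposition 1.2 alone -/

/-- **(2.23) ON THE TORI FROM THE TYPED (7.2.2) AND THE NATIVE (7.2.3), CONSTANTS UNIFORM IN `k`**: given r15's typed `KernelData.Ineq722` for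
p09's torus kernel family `i ↦ torusKernelData P (lev i) (deltaAData …) …` whose scales cover the standing range, and (7.2.3) for the
UNIT-LATTICE matrices `⟨e_b, CE P η_j^d L^j j e_{b′}⟩` in the binder shape `∀ k ≤ m + K, ∀ j < k` with one pair `(M_C, δ_C)`: THERE ARE
`R₀, c₀ ≥ 0, δ′ > 0` such that FOR EVERY `k ≤ m + K`, every fine site `x` and unit bond `b′` with `dist(x,b′) ≥ R₀`,
`|C_k(x, b′)| ≤ c₀e^{−δ′dist(x,b′)}`. [cite: BalabanImbrieJaffe1988, (2.23) p.262] -/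
theorem decay223_Ck_torus_of_ineq722_lt (hd : 2 ≤ P.d) {lev : ℕ → ℕ} (hlev : ∀ i, lev i ≤ P.m + P.K)
    (hcov : ∀ j ≤ P.m + P.K, ∃ i, lev i = j) {a : ℝ} (ha : 0 < a) {BondU : ℕ → Type}
    {distEB : (i : ℕ) → TSite P 0 → BondU i → ℝ} {Cker : (i : ℕ) → Fin P.d → Fin P.d → TSite P (lev i) → TSite P (lev i) → ℝ}
    {Dker : (i : ℕ) → TSite P 0 → BondU i → ℝ}
    (h722 : KernelData.Ineq722
      (fun i => torusKernelData P (lev i) (deltaAData (hlev i) a) (BondU i) (distEB i) (Cker i) (Dker i)))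
    {δC MC : ℝ} (hδC : 0 < δC) (hMC : 0 ≤ MC)
    (hC : ∀ k ≤ P.m + P.K, ∀ j < k, ∀ b b' : PBond P j, |⟪toEj P j (Pi.single b 1),
      CE P ((P.eta j) ^ P.d) ((P.L : ℝ) ^ j) j (toEj P j (Pi.single b' 1))⟫| ≤ MC * Real.exp (-(δC * (supDist b.src b'.src : ℝ)))) :
    ∃ R₀ c₀ δ' : ℝ, 0 < δ' ∧ 0 ≤ c₀ ∧ ∀ (k : ℕ) (hk : k ≤ P.m + P.K) (x : TSite P 0) (b' : PBond P k),
      R₀ ≤ distEU P k x b'.src →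
        |CkE P hd ((P.eta k) ^ P.d) ((P.L : ℝ) ^ k) k (toEj P k (Pi.single b' 1)) x| ≤
          c₀ * Real.exp (-δ' * distEU P k x b'.src) := by
  obtain ⟨δ, M, hδ, hM, hBall⟩ := exists_bound_of_ineq722 hlev h722
  have hHB : ∀ (j : ℕ) (hj : j ≤ P.m + P.K) (μ ν : Fin P.d) (x : TSite P 0) (y : TSite P j),
      |(torusRep P j (deltaAData hj a)).H (x, μ) (y, ν)| +
        ‖fun lam : Fin P.d => (P.L : ℝ) ^ j *
          ((torusRep P j (deltaAData hj a)).H (x.shift lam, μ) (y, ν) - (torusRep P j (deltaAData hj a)).H (x, μ) (y, ν))‖ ≤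
        M * Real.exp (-(δ * distEU P j x y)) := by
    intro j hj μ ν x y
    obtain ⟨i, hi⟩ := hcov j hj
    subst hi
    have h := hBall i μ ν x y
    rwa [torusKernelData_gradH] at h
  refine ⟨2 * δ / (min δ δC / 2) + 4,
    (P.d : ℝ) * M * Real.exp δ +
        4 * (Real.exp P.d * ((P.d : ℝ) ^ 2 * (2 * (1 + (1:ℝ)⁻¹)) ^ P.d)) *
          (2 * (P.d : ℝ) ^ 3 * M ^ 2 * Real.exp δ * MC *
            (Real.exp (min δ δC / 2 / 2) * ((2 * (1 + P.d / (min δ δC / 2))) ^ P.d) ^ 2)) *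
          (((P.d - 2 + 1).factorial : ℝ) / (min δ δC / 2) ^ (P.d - 2 + 1)),
    min δ δC / 2 / 2, ?_, by positivity, fun k hk x b' hfar => ?_⟩
  · have : 0 < min δ δC / 2 := half_pos (lt_min hδ hδC)
    positivity
  have h := abs_CkKernel_le hd hk ha hδ hδC hM hMC
    (fun j hj _ μ ν x'' y => ((le_add_of_nonneg_right (norm_nonneg _)).trans (hHB j hj μ ν x'' y)))
    (fun j hj _ μ ν x'' y => ((le_add_of_nonneg_left (abs_nonneg _)).trans (hHB j hj μ ν x'' y)))
    (hC k hk) hfar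
  rw [neg_mul]
  exact h

/-- **(2.23) ON THE TORI FOR THE `C_k` OF RECORD, GIVEN ONLY [6I] PROPOSITION 1.2 BY ITS TREE NAME** (`B5.Prop12Printed` for p09's torus
family of scales `levStd` — the hypothesis of rows C1.Eq7.2.1-7.2.2 / C2.Eq2.16's files): `∃ R₀ c₀ δ′, 0 < δ′ ∧ 0 ≤ c₀ ∧` for EVERY
`k ≤ m + K`, every `x ∈ T_η`, `b′ ∈ T₁^{(k)*}` with `dist(x,b′) ≥ R₀`: `|C_k(x,b′)| ≤ c₀e^{−δ′dist(x,b′)}` — the (7.2.2) input via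
`ineq722_deltaA_of_prop12Printed`, the (7.2.3) input DISCHARGED by p09's `ineq723_CE_lt` (`BIJ88Decay216Prop12.ineq723_CE_torus`), the
(7.2.4) input PROVED for the `D_j` of record (file 1). [cite: BalabanImbrieJaffe1988, (2.23) p.262] -/
theorem decay223_Ck_torus_prop12 (hd : 2 ≤ P.d) {a : ℝ} (ha : 0 < a)
    (h12 : B5.Prop12Printed (fun i => settingOf (torusRep P (levStd P i) (deltaAData (levStd_le i) a)) i)) :
    ∃ R₀ c₀ δ' : ℝ, 0 < δ' ∧ 0 ≤ c₀ ∧ ∀ (k : ℕ) (hk : k ≤ P.m + P.K) (x : TSite P 0) (b' : PBond P k),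
      R₀ ≤ distEU P k x b'.src →
        |CkE P hd ((P.eta k) ^ P.d) ((P.L : ℝ) ^ k) k (toEj P k (Pi.single b' 1)) x| ≤
          c₀ * Real.exp (-δ' * distEU P k x b'.src) := by
  obtain ⟨MC, δC, hMC, hδC, hC⟩ := ineq723_CE_torus (P := P) hd
  exact decay223_Ck_torus_of_ineq722_lt hd levStd_le (fun j hj => ⟨j, min_eq_left hj⟩) ha
    (ineq722_deltaA_of_prop12Printed (levStd P) levStd_le ha (fun _ => PUnit) (fun _ _ _ => 0) (fun _ _ _ _ _ => 0)
      (fun _ _ _ => 0) h12) hδC hMC.le hC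

/-! ## §3  Row C2.Eq2.23's typed one-letter shape `DecayFar`, in a rescaled distance -/

/-- **a three-constant decay beyond a threshold inhabits r18's one-letter `DecayFar` after rescaling the distance**: if
`|K(a,b)| ≤ c₀e^{−δ′dist(a,b)}` whenever `dist(a,b) ≥ R₀` (`δ′ > 0`, `dist ≥ 0`), then with `c := max(c₀, 1)` and
`κ := min(δ′/c, c/max(R₀, 1))`, `DecayFar (κ·dist) K c` — `c ≤ κ·dist` forces `dist ≥ max(R₀,1)`, and `cκ ≤ δ′`, `c₀ ≤ c`.
[cite: BalabanImbrieJaffe1988, (2.23) p.262] -/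
theorem decayFar_of_decay3 {α β : Type*} {dist : α → β → ℝ} {K : α → β → ℝ} {R₀ c₀ δ' : ℝ} (hδ' : 0 < δ')
    (hdist : ∀ a b, 0 ≤ dist a b) (h : ∀ a b, R₀ ≤ dist a b → |K a b| ≤ c₀ * Real.exp (-δ' * dist a b)) :
    DecayFar (fun a b => min (δ' / max c₀ 1) (max c₀ 1 / max R₀ 1) * dist a b) K (max c₀ 1) := by
  set c : ℝ := max c₀ 1 with hc
  set κ : ℝ := min (δ' / c) (c / max R₀ 1) with hκ
  have hc1 : 1 ≤ c := le_max_right _ _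
  have hc0 : 0 < c := by linarith
  have hR1 : 1 ≤ max R₀ 1 := le_max_right _ _
  have hκ0 : 0 < κ := lt_min (div_pos hδ' hc0) (div_pos hc0 (by linarith))
  intro a b hab
  have hd0 := hdist a b
  -- the threshold: `c ≤ κ·dist ⇒ R₀ ≤ dist`
  have hR : R₀ ≤ dist a b := by
    have h1 : κ * dist a b ≤ c / max R₀ 1 * dist a b := mul_le_mul_of_nonneg_right (min_le_right _ _) hd0
    have h2 : c ≤ c / max R₀ 1 * dist a b := hab.trans h1
    rw [div_mul_eq_mul_div, le_div_iff₀ (by linarith)] at h2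
    have h3 : max R₀ 1 ≤ dist a b := le_of_mul_le_mul_left (by linarith) hc0
    exact (le_max_left _ _).trans h3
  refine (h a b hR).trans ?_
  have hcκ : c * κ ≤ δ' := by
    have := min_le_left (δ' / c) (c / max R₀ 1)
    rw [← hκ] at this
    calc c * κ ≤ c * (δ' / c) := mul_le_mul_of_nonneg_left this hc0.le
      _ = δ' := mul_div_cancel₀ _ hc0.ne'
  calc c₀ * Real.exp (-δ' * dist a b) ≤ c * Real.exp (-δ' * dist a b) :=
        mul_le_mul_of_nonneg_right (le_max_left _ _) (Real.exp_pos _).le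
    _ ≤ c * Real.exp (-c * (κ * dist a b)) := by
        refine mul_le_mul_of_nonneg_left (Real.exp_le_exp.2 ?_) hc0.le
        nlinarith [mul_le_mul_of_nonneg_right hcκ hd0]

/-- **ROW C2.Eq2.23's TYPED SHAPE FOR THE KERNEL OF RECORD, GIVEN ONLY [6I] PROPOSITION 1.2**: `∃ κ > 0, c > 0` such that for EVERY
`k ≤ m + K`, r18's `DecayFar (fun x b′ => κ·dist(x,b′)) (fun x b′ => C_k(x,b′)) c` — *"|C_k(x,b′)| ≦ ce^{−c dist(x,b′)}, dist(x,b′) > c"*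
with ONE letter `c` in the rescaled distance (§4 + `decayFar_of_decay3`). [cite: BalabanImbrieJaffe1988, (2.23) p.262] -/
theorem decayFar223_Ck_torus_prop12 (hd : 2 ≤ P.d) {a : ℝ} (ha : 0 < a)
    (h12 : B5.Prop12Printed (fun i => settingOf (torusRep P (levStd P i) (deltaAData (levStd_le i) a)) i)) :
    ∃ κ c : ℝ, 0 < κ ∧ 0 < c ∧ ∀ (k : ℕ) (hk : k ≤ P.m + P.K),
      DecayFar (fun (x : TSite P 0) (b' : PBond P k) => κ * distEU P k x b'.src)
        (fun x b' => CkE P hd ((P.eta k) ^ P.d) ((P.L : ℝ) ^ k) k (toEj P k (Pi.single b' 1)) x) c := by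
  obtain ⟨R₀, c₀, δ', hδ', hc₀, h⟩ := decay223_Ck_torus_prop12 hd ha h12
  have hc0 : 0 < max c₀ 1 := lt_of_lt_of_le one_pos (le_max_right _ _)
  refine ⟨min (δ' / max c₀ 1) (max c₀ 1 / max R₀ 1), max c₀ 1,
    lt_min (div_pos hδ' hc0) (div_pos hc0 (lt_of_lt_of_le one_pos (le_max_right _ _))), hc0, fun k hk => ?_⟩
  exact decayFar_of_decay3 hδ' (fun x b' => div_nonneg (Nat.cast_nonneg _) (cast_pow_L_pos' k).le)
    (fun x b' hfar => h k hk x b' hfar)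

end

end Literature.MathematicalPhysics.QuantumFieldTheory.BalabanImbrieJaffe1984to88.BIJ88Decay223CkTorus
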